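import Mathlib
import HarnessLib
import Summits.MatrixMultiplication.MatrixMultiplication.Theorems.OutsiderSandwichBlock

/-!
# OutsiderSandwich — the block-descent items over the route declarations (decomp-mm lens-4, g17)

The route file `Theses/OutsiderSandwich.lean` (rev 24) carries the g17 asides `BlockTangency`
(28533), `BlockMergeOptimal` (28534), `BlockIsMM` (28535), `BlockSubrankFull` (28536),
`BlockDiagonal` (28537), `CouplingBenchmark` (28538), `BlockRankLeFour` (28539) — which spell out
the three coupled blocks `C₁ = T^{[211]}, C₂ = T^{[121]}, C₃ = T^{[112]}` of `cw₂ ⊗ cw₂` verbatim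
and are definitionally the Props of `Theorems/OutsiderSandwichBlock.lean` — and the four proved
composite asides `SummitIffBlock` (28540), `BlockDescent` (28541), `SummitIffBlockIsMM` (28542),
`BlockDoor` (28543).  This file records the definitional bridges and closes the four proved asides
by name:

* `summitIffBlock_holds : SummitIffBlock` — `ω = 2 ⟺ BlockTangency ∧ BlockMergeOptimal`, the
  hypothesis-free BLOCK CUT (kernel `summit_iff_block`);
* `blockDescent_holds : BlockDescent` — the descent edges between the g16 coupling layer and the
  g17 block layer (`BlockTangency ⟹ CouplingTangency`, `CouplingMergeOptimal ⟹
  BlockMergeOptimal`, `BlockIsMM ⟹ CouplingIsMM`, `BlockSubrankFull ⟹ CouplingSubrankFull`,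
  `BlockDiagonal ⟹ BlockSubrankFull`, `BlockSubrankFull ⟹ BlockTangency ⟹ BlockIsMM`);
* `summitIffBlockIsMM_holds : SummitIffBlockIsMM` — `BlockSubrankFull ⟹ (ω = 2 ⟺ BlockIsMM ∧
  CouplingMergeOptimal)`, the refined block equivalence whose attacked side is the ω-free
  asymptotic comparison `⟨2,2,2⟩ ≲ C_k`;
* `blockDoor_holds : BlockDoor` — `(CouplingBenchmark ⟹ BlockRankLeFour ⟹ ω = 2) ∧
  (BlockRankLeFour ⟹ CouplingMergeOptimal) ∧ (BlockRankLeFour ⟹ BlockMergeOptimal)`.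

Sources: V. Strassen, J. reine angew. Math. 384 (1988) (asymptotic spectrum, `τ_F`);
V. Strassen, J. reine angew. Math. 413 (1991) (subrank of tight sets, behind `BlockSubrankFull`);
D. Coppersmith, S. Winograd, J. Symb. Comput. 9 (1990) §7 (the coupled blocks of `cw_q ⊗ cw_q`);
M. Christandl, P. Vrana, J. Zuiddam, J. Amer. Math. Soc. 36 (2023) (universal spectral points);
A. Conner, F. Gesmundo, J. M. Landsberg, E. Ventura, Comput. Complexity 31 (2022) (doors of the shape
"`R̃(T)` minimal ⟹ ω = 2", cf. `BlockDoor`).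
-/

noncomputable section

namespace Summit.MatrixMultiplication.MatrixMultiplication.Theorems.OutsiderSandwichBlockItems

open Summit.MatrixMultiplication.MatrixMultiplication

/-! ## 1. Definitional bridges route decl ↔ kernel Prop -/

/-- Item 28533 `BlockTangency` is definitionally the kernel's `BlockTangency`. -/
theorem blockTangency_iff :
    Theses.OutsiderSandwich.BlockTangency ↔ Theorems.OutsiderSandwichBlock.BlockTangency :=
  Iff.rfl

/-- Item 28534 `BlockMergeOptimal` is definitionally the kernel's `BlockMergeOptimal`. -/
theorem blockMergeOptimal_iff :
    Theses.OutsiderSandwich.BlockMergeOptimal ↔ Theorems.OutsiderSandwichBlock.BlockMergeOptimal :=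
  Iff.rfl

/-- Item 28535 `BlockIsMM` is definitionally the kernel's `BlockIsMM`. -/
theorem blockIsMM_iff :
    Theses.OutsiderSandwich.BlockIsMM ↔ Theorems.OutsiderSandwichBlock.BlockIsMM :=
  Iff.rfl

/-- Item 28536 `BlockSubrankFull` is definitionally the kernel's `BlockSubrankFull`. -/
theorem blockSubrankFull_iff :
    Theses.OutsiderSandwich.BlockSubrankFull ↔ Theorems.OutsiderSandwichBlock.BlockSubrankFull :=
  Iff.rfl

/-- Item 28537 `BlockDiagonal` is definitionally the kernel's `BlockDiagonal`. -/
theorem blockDiagonal_iff :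
    Theses.OutsiderSandwich.BlockDiagonal ↔ Theorems.OutsiderSandwichBlock.BlockDiagonal :=
  Iff.rfl

/-- Item 28538 `CouplingBenchmark` is definitionally the kernel's `CouplingBenchmark`. -/
theorem couplingBenchmark_iff :
    Theses.OutsiderSandwich.CouplingBenchmark ↔ Theorems.OutsiderSandwichBlock.CouplingBenchmark :=
  Iff.rfl

/-- Item 28539 `BlockRankLeFour` is definitionally the kernel's `BlockRankLeFour`. -/
theorem blockRankLeFour_iff :
    Theses.OutsiderSandwich.BlockRankLeFour ↔ Theorems.OutsiderSandwichBlock.BlockRankLeFour :=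
  Iff.rfl

/-! ## 2. The four proved asides, by name -/

/-- Item 28540: `ω = 2 ⟺ BlockTangency ∧ BlockMergeOptimal` — the block cut is exact. -/
theorem summitIffBlock_holds : Theses.OutsiderSandwich.SummitIffBlock :=
  Theorems.OutsiderSandwichBlock.summit_iff_block

/-- Item 28541: the six descent edges between the coupling layer (g16) and the block layer (g17). -/
theorem blockDescent_holds : Theses.OutsiderSandwich.BlockDescent :=
  ⟨Theorems.OutsiderSandwichBlock.couplingTangency_of_blockTangency,
    Theorems.OutsiderSandwichBlock.blockMergeOptimal_of_couplingMergeOptimal,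
    Theorems.OutsiderSandwichBlock.couplingIsMM_of_blockIsMM,
    Theorems.OutsiderSandwichBlock.couplingSubrankFull_of_blockSubrankFull,
    Theorems.OutsiderSandwichBlock.blockSubrankFull_of_diagonal,
    Theorems.OutsiderSandwichBlock.blockIsMM_of_blockTangency⟩

/-- Item 28542: `BlockSubrankFull ⟹ (ω = 2 ⟺ BlockIsMM ∧ CouplingMergeOptimal)`. -/
theorem summitIffBlockIsMM_holds : Theses.OutsiderSandwich.SummitIffBlockIsMM :=
  Theorems.OutsiderSandwichBlock.summit_iff_blockIsMM

/-- Item 28543: the door `(CouplingBenchmark ⟹ BlockRankLeFour ⟹ ω = 2) ∧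
(BlockRankLeFour ⟹ CouplingMergeOptimal) ∧ (BlockRankLeFour ⟹ BlockMergeOptimal)`. -/
theorem blockDoor_holds : Theses.OutsiderSandwich.BlockDoor :=
  ⟨Theorems.OutsiderSandwichBlock.summit_of_blockRankLeFour,
    Theorems.OutsiderSandwichBlock.couplingMergeOptimal_of_blockRankLeFour,
    Theorems.OutsiderSandwichBlock.blockMergeOptimal_of_blockRankLeFour⟩

/-! ## 3. Edges over the route decls -/

/-- The block cut decides the summit, over the route decls:
`BlockTangency ⟹ BlockMergeOptimal ⟹ ω = 2`. -/
theorem summit_of_block (h₁ : Theses.OutsiderSandwich.BlockTangency)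
    (h₂ : Theses.OutsiderSandwich.BlockMergeOptimal) : _root_.MatrixMultiplication :=
  Theorems.OutsiderSandwichBlock.summit_of_block h₁ h₂

/-- The refined block cut decides the summit, over the route decls:
`BlockSubrankFull ⟹ BlockIsMM ⟹ CouplingMergeOptimal ⟹ ω = 2`. -/
theorem summit_of_blockIsMM (hQ : Theses.OutsiderSandwich.BlockSubrankFull)
    (h₁ : Theses.OutsiderSandwich.BlockIsMM) (h₂ : Theses.OutsiderSandwich.CouplingMergeOptimal) :
    _root_.MatrixMultiplication :=
  (Theorems.OutsiderSandwichBlock.summit_iff_blockIsMM hQ).2 ⟨h₁, h₂⟩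

/-- `BlockSubrankFull ⟹ ω = 2 ⟹ BlockIsMM` — the ω-free leaf is NECESSARY, over the route decls. -/
theorem blockIsMM_of_summit (hQ : Theses.OutsiderSandwich.BlockSubrankFull)
    (hS : _root_.MatrixMultiplication) : Theses.OutsiderSandwich.BlockIsMM :=
  Theorems.OutsiderSandwichBlock.blockIsMM_of_summit hQ hS

/-- The block leaf feeds the cut of record: `SquaredLaserPacking ⟹ BlockIsMM ⟹ LaserTangency`
(item 32268), over the route decls. -/
theorem laserTangency_of_blockIsMM (hP : Theses.OutsiderSandwich.SquaredLaserPacking)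
    (h : Theses.OutsiderSandwich.BlockIsMM) : Theses.OutsiderSandwich.LaserTangency :=
  Theorems.OutsiderSandwichBlock.laserTangency_of_blockIsMM hP h

/-- Given the block floor and the coupling residual, the block leaf and the block tangency coincide:
`BlockSubrankFull ⟹ CouplingMergeOptimal ⟹ (BlockIsMM ⟺ BlockTangency)`. -/
theorem blockIsMM_iff_blockTangency (hQ : Theses.OutsiderSandwich.BlockSubrankFull)
    (hR : Theses.OutsiderSandwich.CouplingMergeOptimal) :
    Theses.OutsiderSandwich.BlockIsMM ↔ Theses.OutsiderSandwich.BlockTangency := by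
  refine ⟨fun h => ?_, Theorems.OutsiderSandwichBlock.blockIsMM_of_blockTangency hQ⟩
  exact Theorems.OutsiderSandwichBlock.blockTangency_of_summit
    ((Theorems.OutsiderSandwichBlock.summit_iff_blockIsMM hQ).2 ⟨h, hR⟩)

end Summit.MatrixMultiplication.MatrixMultiplication.Theorems.OutsiderSandwichBlockItems
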